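import Summits.QuantumAdvantage.QuantumAdvantage.Theorems.CubicForrelationNearExactIsExactBentFibreStructure
import Summits.QuantumAdvantage.QuantumAdvantage.Theorems.CubicForrelationNearExactIsExactBentLadderFourteen

/-!
# Crux `CubicForrelation.NearExactIsExact` (stmt-QuantumAdvantage-14043) — bent-side line `|S| = 1.5·d_min`: on `S` the partner shifts by a
  CONSTANT along `W' = Fix(A) ∩ Fix(P)` (consequence of the fibre structure; part 1 of the `n = 14`, `Φ = 29/32` kill)

Certificate seat `b2b-cforr-cert` (gen 44).  SPLIT for the 400-line rule: this is PART 1 (`kb_shift_case`, `kb_shift_on_S`, any `n`); PART 2 is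
…BentFourteenTwentyNineThirtySeconds (the theorem).  HONEST FRAMING: a kernel-checked finite-slice THEOREM (standard axioms) — the only window-relevant
line of THEOREM BENT14 (DISPROOF.md §18.3: `|S| = 768`, `Φ = 29/32`), now in Lean: for cubic `f, g : 𝔽₂¹⁴ → 𝔽₂` with `g` bent, `Φ(f,g) ≠ 29/32`.
With `fo_bent_false` (`Φ ≠ 15/16`, …FourteenSecondBent) and the second weight of `RM(5,14)` this closes the bent side of the `n = 14` window
down to the record `57/64` (corollary below).  NOT summit progress; `θ₁₄ ∈ [57/64, 61/64)` is unchanged (the window's remaining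
configurations have both sides non-bent).

Proof.  `g̃ = d` has degree `≤ 5` (Hou), `S = {f ≠ d}` has `768 = 1.5·2⁹` points, so `f ⊕ d = (A₀A₁ ⊕ A₂A₃) ∧ P₀P₁P₂` (Kasami–Tokura,
`kh_structure_rm5_fourteen_768`).  The ladder on 4-flats inside `{P = 1}` (`kb_ladder_four`) and the fibre structure (`kb_fibre_structure`) give:
for `t ∈ W' = Fix(A) ∩ Fix(P)` the partner changes along `t` by a constant on `S`, `f(x ⊕ t) = f(x) ⊕ λ(t)` (`kb_shift_on_S`).  Hence the
partial transform `D(y) = Σ_{x∈S} (−1)^{d(x)+x·y}` satisfies `D(y) = ψ_y(t)·D(y)` for the character `ψ_y(t) = (−1)^{λ(t)+t·y}` of `W'`: either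
`D(y) = 0`, or `(−1)^{d+⟨·,y⟩}` is constant on each of the six classes `{P = 1, A = p}` (`Q(p) = 1`), all of size `128` — so `D(y) ∈ 256ℤ`.
The plateau bound `kb_bent_gap_bound` (`2⁷·#S·256 ≤ Σ_y D(y)² = 2¹⁴·#S`, Parseval) is then violated.

References: T. Kasami, N. Tokura (1970) Thm 1; O. S. Rothaus (1976); X.-D. Hou (1998); DISPROOF.md §18.  Axioms: the standard three.
-/

set_option linter.dupNamespace false -- D-0017: single-problem summit ⇒ `QuantumAdvantage.QuantumAdvantage` by design

noncomputable section

namespace Summit.QuantumAdvantage.QuantumAdvantage.Theorems.CubicForrelation.NearExactIsExact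

open Finset
open Literature.Computability.QuantumComplexity
open Literature.Computability.QuantumComplexity.BuzetChailloux (bxor zeroVec bxor_self bxor_zeroVec zeroVec_bxor bxor_comm
  bxor_bxor_cancel_left signOf_sq)
open Literature.Computability.QuantumComplexity.DerivativeWalsh (W twist_bxor_left sum_W_sq)
open Literature.Computability.QuantumComplexity.Simon (twist_eq_one_or)

variable {n : ℕ}

/-! ### The partner shifts by a constant along `W'` on `S` -/

/-- One pattern class: if `f((w₀ ⊕ t) ⊕ c) = γ(w₀ ⊕ t) ⊕ κ` for every `t ∈ W'` and `γ` is affine along `W'` from `w₀`, then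
`f(((w₀ ⊕ t') ⊕ c) ⊕ t) = f((w₀ ⊕ t') ⊕ c) ⊕ γ(w₀ ⊕ t) ⊕ γ(w₀)` for `t, t' ∈ W'`. [this work] -/
theorem kb_shift_case {s : ℕ} (f : (Fin n → Bool) → Bool) (A : Fin 4 → (Fin n → Bool) → Bool) (P : Fin s → (Fin n → Bool) → Bool)
    (w₀ c : Fin n → Bool) (γ : (Fin n → Bool) → Bool) (κ : Bool)
    (hγ : ∀ s' t, (∀ i x, A i (bxor x s') = A i x) → (∀ j x, P j (bxor x s') = P j x) →
      (∀ i x, A i (bxor x t) = A i x) → (∀ j x, P j (bxor x t) = P j x) →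
      γ (bxor (bxor w₀ s') t) = ((γ (bxor w₀ s') ^^ γ (bxor w₀ t)) ^^ γ w₀))
    (hc : ∀ t, (∀ i x, A i (bxor x t) = A i x) → (∀ j x, P j (bxor x t) = P j x) → f (bxor (bxor w₀ t) c) = (γ (bxor w₀ t) ^^ κ))
    (t' t : Fin n → Bool)
    (ht'A : ∀ i x, A i (bxor x t') = A i x) (ht'P : ∀ j x, P j (bxor x t') = P j x)
    (htA : ∀ i x, A i (bxor x t) = A i x) (htP : ∀ j x, P j (bxor x t) = P j x) :
    f (bxor (bxor (bxor w₀ t') c) t) = (f (bxor (bxor w₀ t') c) ^^ (γ (bxor w₀ t) ^^ γ w₀)) := by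
  have h1 := hc t' ht'A ht'P
  have h2 := hc (bxor t' t) (fun i x => by rw [← iw_bxor_assoc, htA, ht'A]) (fun j x => by rw [← iw_bxor_assoc, htP, ht'P])
  have e : bxor (bxor w₀ (bxor t' t)) c = bxor (bxor (bxor w₀ t') c) t := by
    funext l; simp only [BuzetChailloux.bxor]
    cases w₀ l <;> cases t' l <;> cases t l <;> cases c l <;> rfl
  rw [e, ← iw_bxor_assoc, hγ t' t ht'A ht'P htA htP] at h2
  rw [h2, h1]
  cases γ (bxor w₀ t') <;> cases γ (bxor w₀ t) <;> cases γ w₀ <;> cases κ <;> rfl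

/-- **On `S` the partner changes along `W'` by a constant.**  From the fibre structure (`kb_fibre_structure`): for `t ∈ W' = Fix(A) ∩ Fix(P)` and
`x ∈ S = {f ≠ d}`, `f(x ⊕ t) = f(x) ⊕ γ(w₀ ⊕ t) ⊕ γ(w₀)`. [this work] -/
theorem kb_shift_on_S {s : ℕ} (f d : (Fin n → Bool) → Bool) (A : Fin 4 → (Fin n → Bool) → Bool) (P : Fin s → (Fin n → Bool) → Bool)
    (v : Fin 4 → Fin n → Bool) (hA : ∀ i, IsDegLeFun 1 (A i)) (hP : ∀ j, IsDegLeFun 1 (P j))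
    (hAv : ∀ i x, A i (bxor x (v i)) = !A i x) (hAv' : ∀ i k x, i ≠ k → A i (bxor x (v k)) = A i x)
    (hPv : ∀ j k x, P j (bxor x (v k)) = P j x)
    (hnf : ∀ x, (f x ^^ d x) = (((A 0 x && A 1 x) ^^ (A 2 x && A 3 x)) && decide (∀ j, P j x = true)))
    (w₀ : Fin n → Bool) (hw₀P : ∀ j, P j w₀ = true) (hw₀A : ∀ i, A i w₀ = false)
    (α₀ α₁ α₂ α₃ : Bool) (γ : (Fin n → Bool) → Bool)
    (hγ : ∀ s' t, (∀ i x, A i (bxor x s') = A i x) → (∀ j x, P j (bxor x s') = P j x) →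
      (∀ i x, A i (bxor x t) = A i x) → (∀ j x, P j (bxor x t) = P j x) →
      γ (bxor (bxor w₀ s') t) = ((γ (bxor w₀ s') ^^ γ (bxor w₀ t)) ^^ γ w₀))
    (hfib : ∀ t, (∀ i x, A i (bxor x t) = A i x) → (∀ j x, P j (bxor x t) = P j x) →
        f (bxor (bxor (bxor w₀ t) (v 1)) (v 0)) = (γ (bxor w₀ t) ^^ (α₀ ^^ α₁)) ∧
        f (bxor (bxor (bxor (bxor w₀ t) (v 2)) (v 1)) (v 0)) = ((true ^^ γ (bxor w₀ t)) ^^ ((α₀ ^^ α₁) ^^ α₂)) ∧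
        f (bxor (bxor (bxor (bxor w₀ t) (v 3)) (v 1)) (v 0)) = (γ (bxor w₀ t) ^^ ((α₀ ^^ α₁) ^^ α₃)) ∧
        f (bxor (bxor (bxor w₀ t) (v 3)) (v 2)) = (γ (bxor w₀ t) ^^ (α₂ ^^ α₃)) ∧
        f (bxor (bxor (bxor (bxor w₀ t) (v 3)) (v 2)) (v 0)) = (γ (bxor w₀ t) ^^ ((α₀ ^^ α₂) ^^ α₃)) ∧
        f (bxor (bxor (bxor (bxor w₀ t) (v 3)) (v 2)) (v 1)) = (γ (bxor w₀ t) ^^ ((α₁ ^^ α₂) ^^ α₃)))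
    (t : Fin n → Bool) (htA : ∀ i x, A i (bxor x t) = A i x) (htP : ∀ j x, P j (bxor x t) = P j x)
    (x : Fin n → Bool) (hx : (f x ^^ d x) = true) :
    f (bxor x t) = (f x ^^ (γ (bxor w₀ t) ^^ γ w₀)) := by
  classical
  rw [hnf x, Bool.and_eq_true] at hx
  have hQ := hx.1
  have hPx := of_decide_eq_true hx.2
  -- shift rules
  have r01 : ∀ x, A 0 (bxor x (v 1)) = A 0 x := fun x => hAv' 0 1 x (by decide)
  have r02 : ∀ x, A 0 (bxor x (v 2)) = A 0 x := fun x => hAv' 0 2 x (by decide)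
  have r03 : ∀ x, A 0 (bxor x (v 3)) = A 0 x := fun x => hAv' 0 3 x (by decide)
  have r10 : ∀ x, A 1 (bxor x (v 0)) = A 1 x := fun x => hAv' 1 0 x (by decide)
  have r12 : ∀ x, A 1 (bxor x (v 2)) = A 1 x := fun x => hAv' 1 2 x (by decide)
  have r13 : ∀ x, A 1 (bxor x (v 3)) = A 1 x := fun x => hAv' 1 3 x (by decide)
  have r20 : ∀ x, A 2 (bxor x (v 0)) = A 2 x := fun x => hAv' 2 0 x (by decide)
  have r21 : ∀ x, A 2 (bxor x (v 1)) = A 2 x := fun x => hAv' 2 1 x (by decide)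
  have r23 : ∀ x, A 2 (bxor x (v 3)) = A 2 x := fun x => hAv' 2 3 x (by decide)
  have r30 : ∀ x, A 3 (bxor x (v 0)) = A 3 x := fun x => hAv' 3 0 x (by decide)
  have r31 : ∀ x, A 3 (bxor x (v 1)) = A 3 x := fun x => hAv' 3 1 x (by decide)
  have r32 : ∀ x, A 3 (bxor x (v 2)) = A 3 x := fun x => hAv' 3 2 x (by decide)
  have f0 := hAv 0
  have f1 := hAv 1
  have f2 := hAv 2
  have f3 := hAv 3
  -- a translation fixing `A` and `P` at one point fixes them everywhere (affine)
  have fixOf : ∀ t' : Fin n → Bool, (∀ i, A i (bxor w₀ t') = A i w₀) → (∀ j, P j (bxor w₀ t') = P j w₀) →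
      (∀ i z, A i (bxor z t') = A i z) ∧ (∀ j z, P j (bxor z t') = P j z) := by
    intro t' hAt hPt
    refine ⟨fun i z => ?_, fun j z => ?_⟩
    · obtain ⟨ε, hε⟩ := kh_affine_shift (A i) (hA i) t'
      have h := hε w₀
      rw [hAt i] at h
      have : ε = false := by revert h; cases A i w₀ <;> cases ε <;> simp
      rw [hε, this, Bool.xor_false]
    · obtain ⟨ε, hε⟩ := kh_affine_shift (P j) (hP j) t'
      have h := hε w₀
      rw [hPt j] at h
      have : ε = false := by revert h; cases P j w₀ <;> cases ε <;> simp
      rw [hε, this, Bool.xor_false]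
  -- the six pattern classes as `κ`-equations at points `(w₀ ⊕ t) ⊕ c`
  have c1 : ∀ t, (∀ i x, A i (bxor x t) = A i x) → (∀ j x, P j (bxor x t) = P j x) →
      f (bxor (bxor w₀ t) (bxor (v 1) (v 0))) = (γ (bxor w₀ t) ^^ (α₀ ^^ α₁)) := by
    intro t h1 h2; rw [← iw_bxor_assoc]; exact (hfib t h1 h2).1
  have c2 : ∀ t, (∀ i x, A i (bxor x t) = A i x) → (∀ j x, P j (bxor x t) = P j x) →
      f (bxor (bxor w₀ t) (bxor (bxor (v 2) (v 1)) (v 0))) = (γ (bxor w₀ t) ^^ !((α₀ ^^ α₁) ^^ α₂)) := by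
    intro t h1 h2; rw [← iw_bxor_assoc, ← iw_bxor_assoc, (hfib t h1 h2).2.1]
    cases γ (bxor w₀ t) <;> cases ((α₀ ^^ α₁) ^^ α₂) <;> rfl
  have c3 : ∀ t, (∀ i x, A i (bxor x t) = A i x) → (∀ j x, P j (bxor x t) = P j x) →
      f (bxor (bxor w₀ t) (bxor (bxor (v 3) (v 1)) (v 0))) = (γ (bxor w₀ t) ^^ ((α₀ ^^ α₁) ^^ α₃)) := by
    intro t h1 h2; rw [← iw_bxor_assoc, ← iw_bxor_assoc]; exact (hfib t h1 h2).2.2.1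
  have c4 : ∀ t, (∀ i x, A i (bxor x t) = A i x) → (∀ j x, P j (bxor x t) = P j x) →
      f (bxor (bxor w₀ t) (bxor (v 3) (v 2))) = (γ (bxor w₀ t) ^^ (α₂ ^^ α₃)) := by
    intro t h1 h2; rw [← iw_bxor_assoc]; exact (hfib t h1 h2).2.2.2.1
  have c5 : ∀ t, (∀ i x, A i (bxor x t) = A i x) → (∀ j x, P j (bxor x t) = P j x) →
      f (bxor (bxor w₀ t) (bxor (bxor (v 3) (v 2)) (v 0))) = (γ (bxor w₀ t) ^^ ((α₀ ^^ α₂) ^^ α₃)) := by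
    intro t h1 h2; rw [← iw_bxor_assoc, ← iw_bxor_assoc]; exact (hfib t h1 h2).2.2.2.2.1
  have c6 : ∀ t, (∀ i x, A i (bxor x t) = A i x) → (∀ j x, P j (bxor x t) = P j x) →
      f (bxor (bxor w₀ t) (bxor (bxor (v 3) (v 2)) (v 1))) = (γ (bxor w₀ t) ^^ ((α₁ ^^ α₂) ^^ α₃)) := by
    intro t h1 h2; rw [← iw_bxor_assoc, ← iw_bxor_assoc]; exact (hfib t h1 h2).2.2.2.2.2
  -- generic dispatch for a class vector `c` with `x`'s pattern: `t' = x ⊕ w₀ ⊕ c`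
  have main : ∀ (c : Fin n → Bool) (κ : Bool),
      (∀ t, (∀ i x, A i (bxor x t) = A i x) → (∀ j x, P j (bxor x t) = P j x) → f (bxor (bxor w₀ t) c) = (γ (bxor w₀ t) ^^ κ)) →
      A 0 (bxor x c) = false → A 1 (bxor x c) = false → A 2 (bxor x c) = false → A 3 (bxor x c) = false →
      (∀ j, P j (bxor x c) = P j x) →
      f (bxor x t) = (f x ^^ (γ (bxor w₀ t) ^^ γ w₀)) := by
    intro c κ hc hc0 hc1 hc2 hc3 hPc
    have hAc : ∀ i, A i (bxor x c) = false := by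
      intro i
      fin_cases i
      · exact hc0
      · exact hc1
      · exact hc2
      · exact hc3
    have e1 : bxor w₀ (bxor (bxor x w₀) c) = bxor x c := by
      funext l; simp only [BuzetChailloux.bxor]; cases w₀ l <;> cases x l <;> cases c l <;> rfl
    have e2 : bxor (bxor w₀ (bxor (bxor x w₀) c)) c = x := by
      funext l; simp only [BuzetChailloux.bxor]; cases w₀ l <;> cases x l <;> cases c l <;> rfl
    obtain ⟨ht'A, ht'P⟩ := fixOf (bxor (bxor x w₀) c) (fun i => by rw [e1, hAc i, hw₀A i]) (fun j => by rw [e1, hPc j, hPx j, hw₀P j])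
    have h := kb_shift_case f A P w₀ c γ κ hγ hc (bxor (bxor x w₀) c) t ht'A ht'P htA htP
    rwa [e2] at h
  -- the sixteen patterns of `x`
  cases hA0 : A 0 x <;> cases hA1 : A 1 x <;> cases hA2 : A 2 x <;> cases hA3 : A 3 x <;>
    rw [hA0, hA1, hA2, hA3] at hQ
  all_goals first
    | exact absurd hQ (by decide)
    | skip
  · -- 0011
    refine main _ _ c4 ?_ ?_ ?_ ?_ (fun j => by rw [← iw_bxor_assoc, hPv, hPv])
    · simp only [← iw_bxor_assoc, r03, r02, hA0]
    · simp only [← iw_bxor_assoc, r13, r12, hA1]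
    · simp only [← iw_bxor_assoc, r23, f2, hA2, Bool.not_true]
    · simp only [← iw_bxor_assoc, f3, r32, hA3, Bool.not_true]
  · -- 0111
    refine main _ _ c6 ?_ ?_ ?_ ?_ (fun j => by rw [← iw_bxor_assoc, ← iw_bxor_assoc, hPv, hPv, hPv])
    · simp only [← iw_bxor_assoc, r03, r02, r01, hA0]
    · simp only [← iw_bxor_assoc, r13, r12, f1, hA1, Bool.not_true]
    · simp only [← iw_bxor_assoc, r23, f2, r21, hA2, Bool.not_true]
    · simp only [← iw_bxor_assoc, f3, r32, r31, hA3, Bool.not_true]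
  · -- 1011
    refine main _ _ c5 ?_ ?_ ?_ ?_ (fun j => by rw [← iw_bxor_assoc, ← iw_bxor_assoc, hPv, hPv, hPv])
    · simp only [← iw_bxor_assoc, r03, r02, f0, hA0, Bool.not_true]
    · simp only [← iw_bxor_assoc, r13, r12, r10, hA1]
    · simp only [← iw_bxor_assoc, r23, f2, r20, hA2, Bool.not_true]
    · simp only [← iw_bxor_assoc, f3, r32, r30, hA3, Bool.not_true]
  · -- 1100
    refine main _ _ c1 ?_ ?_ ?_ ?_ (fun j => by rw [← iw_bxor_assoc, hPv, hPv])
    · simp only [← iw_bxor_assoc, r01, f0, hA0, Bool.not_true]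
    · simp only [← iw_bxor_assoc, f1, r10, hA1, Bool.not_true]
    · simp only [← iw_bxor_assoc, r21, r20, hA2]
    · simp only [← iw_bxor_assoc, r31, r30, hA3]
  · -- 1101
    refine main _ _ c3 ?_ ?_ ?_ ?_ (fun j => by rw [← iw_bxor_assoc, ← iw_bxor_assoc, hPv, hPv, hPv])
    · simp only [← iw_bxor_assoc, r03, r01, f0, hA0, Bool.not_true]
    · simp only [← iw_bxor_assoc, r13, f1, r10, hA1, Bool.not_true]
    · simp only [← iw_bxor_assoc, r23, r21, r20, hA2]
    · simp only [← iw_bxor_assoc, f3, r31, r30, hA3, Bool.not_true]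
  · -- 1110
    refine main _ _ c2 ?_ ?_ ?_ ?_ (fun j => by rw [← iw_bxor_assoc, ← iw_bxor_assoc, hPv, hPv, hPv])
    · simp only [← iw_bxor_assoc, r02, r01, f0, hA0, Bool.not_true]
    · simp only [← iw_bxor_assoc, r12, f1, r10, hA1, Bool.not_true]
    · simp only [← iw_bxor_assoc, f2, r21, r20, hA2, Bool.not_true]
    · simp only [← iw_bxor_assoc, r32, r31, r30, hA3]

end Summit.QuantumAdvantage.QuantumAdvantage.Theorems.CubicForrelation.NearExactIsExact

end
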